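import Summits.QuantumFields.YangMills.Theorems.AlphaInputsT3ACv3RecordSelChi
import HarnessLib

/-!
# `AlphaInputsT3ACv3RecordSelXsChi` — ONE CURRENCY IN THE CLASS (★★OWNER RULING g26-№8 (1)(α)): the (67)-largeness conjunct of the seam-blind class in the
# RECORDING currency (`large67RecSet`: symmetric `blockAvg ℰp` iterate, `dist1`, threshold `eps1Of`), the class variant `𝒞_Xs = adaptedClassT3Xs`, the «selection»
# display of 2′χ over it, and the ONE displayed consumer row (the comb↔symmetric seam at `hLF67`) — lane `pub-balaban3d`, width seat alpha-2 (g7)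

WHY (cell `ym3-torus`, route `UnitScaleTilt`, crux `HistoryTailL` = stmt-QuantumFields-19936, stub 2′χ; this seat's NODE-O d = 3 bill v1.1 §6 L4 = ★★OWNER RULING g26-№2∕№8;
LEAD ★w1-19936 g3 B1 PLAN v1).  The history masses RECORD largeness of the level-`j` integration variable in the currency `eps1Of S K j ≤ dist1 (plaqHol V_j p)`
(`Carriers.Masses.stepWeight`), the constraint (3)∕(42) and the tower's averaging read the SYMMETRIC `blockAvg ℰp` (RULING g25-№3), but the seam-blind class `𝒞_X` of
`…v3AdaptedClassX` reads (67) in the [B7] COMB currency `‖hol (avgIter F.L (liftCfg U) j) − 1‖` at the SAME threshold — so for PRINT's minimiser map (B1) the (67) conjunct is a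
comb-vs-symmetric comparison without margin, not bookkeeping.  RULING g26-№8 (1)(α): ONE currency in the class — `large67RecSet` in recording currency, class variant `𝒞_Xs`, the
selection display over it; the comb↔symmetric seam is confined to ONE displayed consumer row at `hLF67` (to be discharged by a named comparison lemma, M, or by a symmetric-letter
re-reading of (69)–(71); NOT here).  THIS FILE (nothing deleted: `𝒞_X`, `InClassSelT3X`, the Sel display stay as the comb-currency objects):
* §1 `AlphaInputsT3AC.large67RecSet`, `AlphaInputsT3AC.adaptedClassT3Xs` (= `𝒞_X` with `large67Set ↦ large67RecSet`), the displayed seam row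
  `AlphaInputsT3AC.Large67CombOfRecT3 K` («read-regular small-loop configurations that are recording-large at the recorded plaquettes are comb-large there»), the inclusion
  `adaptedClassT3Xs ⊆ adaptedClassT3X` under it, and the r-67 BOOKKEEPING lemma `mem_large67RecSet_of_plaqHol_eq` (constraint (3) at recorded-large frozen fields ⇒ membership).
* §2 the selection rows over `𝒞_Xs`: `InClassSelT3Xs`, (O‴χₛ) `DataRowsT3XsChiSel`, and `dataRowsT3XChiSel_of_Xs` ((O‴χₛ) + seam row ⇒ (O‴χ)).
* §3 the record-parametric display `PinnedPartsT3ACRecSelXsChi L` (per family: the seam row + (O‴χₛ)), `pinnedPartsT3ACRecSelChi_of_recSelXsChi`, ★★★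
  `alphaInputsT3ACv3RecChi_of_pinnedPartsRecSelXsChi`, `historyTailL_of_pinnedPartsRecSelXsChi`, and the one-supplier closer ★★★ `historyTailL_of_thm1In8_selXsDataRows_allL`.
HONEST FRAMING.  `def … : Prop`∕`Set` below are HYPOTHESIS SCHEMAS ∕ carriers, never asserted; every theorem is bookkeeping (set inclusions, transport of the sibling files'
closers).  The seam row `Large67CombOfRecT3` is DISPLAYED, not proved (it is the comparison of RULING g26-№8 (1)); `𝒞_Xs` is NOT compared with the (FL)-display of record (the
two (67) currencies are incomparable), so «nothing lost» is NOT claimed here — `𝒞_Xs` is the class for PRINT's map (B1).  Nothing of the cluster expansion, of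
[Balaban1985Variational] Thm 1 or of [Balaban1985Averaging] is proved.  Count-neutral helper toward 2′χ (`--supports stmt-QuantumFields-19936`); registry untouched.  YM₃ on the
three-torus is rung R3 of the programme, not the Clay problem: nothing here is a claim about d = 4, infinite volume, or a mass gap.

References: T. Bałaban, Commun. Math. Phys. 102 (1985) 255–275 [Balaban1985UV3] ((7) p.257, (40)–(42) p.266, (47) p.267, (67)–(71) p.273, Thm 2 p.272); Commun. Math. Phys. 102
(1985) 277–309 [Balaban1985Variational] ((3) p.278, Thm 1 (8) p.279); Commun. Math. Phys. 98 (1985) 17–51 [Balaban1985Averaging] ((42)–(43) p.25).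
-/

set_option autoImplicit false

noncomputable section

namespace Summit.QuantumFields.YangMills.Theorems

open MeasureTheory Set
open scoped Matrix Matrix.Norms.L2Operator
open Literature.MathematicalPhysics.QuantumFieldTheory.Balaban1983to89
open Literature.MathematicalPhysics.QuantumFieldTheory.Balaban1983to89.T3ContinuumYM3Torus
open Literature.MathematicalPhysics.QuantumFieldTheory.Balaban1983to89.T3UnitLawDensityEML (ℰp)
open Literature.MathematicalPhysics.QuantumFieldTheory.Balaban1983to89.T3UnitScaleTilt (θBal)
open Literature.MathematicalPhysics.QuantumFieldTheory.Balaban1983to89.T3PrintedMinimiserExistence (Thm1GlobalMinAt)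
open Literature.MathematicalPhysics.QuantumFieldTheory.Balaban1983to89.T3LowerAlongMinimisersSplit (MinimisersIn8At)
open Literature.MathematicalPhysics.QuantumFieldTheory.Balaban1983to89.ExpMeanLog (deltaSU)
open Literature.MathematicalPhysics.QuantumFieldTheory.Balaban1985CMP102.Setting
open Summit.QuantumFields.Balaban3D.Carriers
open Summit.QuantumFields.Balaban3D.Proofs.Primitives
open Summit.QuantumFields.Balaban3D.Proofs.GroupModelLieC (lieC)
open Summit.QuantumFields.Balaban3D.Proofs.StandardAC
open Summit.QuantumFields.Balaban3D.Proofs.InputsAC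
open Summit.QuantumFields.Balaban3D.Proofs.AlphaAC (AlphaDataAC)
open Summit.QuantumFields.Balaban3D.Proofs.Thresholds (Q0 Q0_pos)
open Summit.QuantumFields.YangMills.Theorems.AlphaV3AC
open B7Prop2Explicit (C0 C0_pos)

/-! ## §1 The (67) conjunct in recording currency, the class `𝒞_Xs`, the displayed seam row -/

section ClassXsDefs

variable (F : T3Family) (𝔠 : AlphaConsts F.L (suGroupModel 2).N) (γ : ℝ) (hγ : 0 < γ) (hγ1 : γ ≤ (min 𝔠.gamma0 1) ^ 2) (K : ℕ)

/-- **THE (67)-LARGENESS SET IN RECORDING CURRENCY** (RULING g26-№8 (1)(α)): configurations `Ũ` of the finest lattice whose `j`-fold SYMMETRIC average `(blockAvg ℰp)^j Ũ` has, at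
every recorded large-field plaquette `p ∈ P_j(h)` (`p ∈ h j`), `dist1 (plaqHol … p) ≥ eps1Of S K j = g_j p(g_j)` — LETTER FOR LETTER the ζ-clause of `Carriers.Masses.stepWeight`
read on the average, so that for a map satisfying print's constraint (3) at recorded-large frozen fields membership is bookkeeping (`mem_large67RecSet_of_plaqHol_eq`).
[cite: Balaban1985UV3, (7) p.257 + (40) p.266 + (67) p.273] -/
def AlphaInputsT3AC.large67RecSet (k : ℕ) (h : Hist (F.P K) k) : Set (GaugeField (F.P K) 0 (Matrix.specialUnitaryGroup (Fin 2) ℂ)) :=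
  {U | ∀ (j : Fin k) (p : Plaq (F.P K) j), p ∈ h j →
    eps1Of (T3Scales F γ hγ (hγ1.trans (sq_min_one_le _ 𝔠.gamma0_pos)) K) 𝔠.lane.carrier j ≤
      GaugeGroup.dist1 (GaugeField.plaqHol (Averaging.iter (fun l => BlockAveraging.blockAvg (P := F.P K) (j := l) ℰp) j U) p)}

/-- **THE SEAM-BLIND ADAPTED CLASS IN ONE CURRENCY `𝒞_Xs(k, h, W)`** (RULING g26-№8 (1)(α)): `𝒞_X` (`adaptedClassT3X`) with its comb-currency (67) conjunct `large67Set` replaced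
by `large67RecSet` — the seam-blind small-loop class, the read-local (68) set, recording-currency (67)-largeness, and for a CHARGED datum the top constraint (42) with r3.
The class for PRINT's minimiser map (B1). [cite: Balaban1985UV3, (42) p.266 + (67)–(68) p.273] -/
def AlphaInputsT3AC.adaptedClassT3Xs (k : ℕ) (h : Hist (F.P K) k) (W : GaugeField (F.P K) k (Matrix.specialUnitaryGroup (Fin 2) ℂ)) :
    Set (GaugeField (F.P K) 0 (Matrix.specialUnitaryGroup (Fin 2) ℂ)) :=
  {U | U ∈ AlphaInputsT3AC.localSmallT3X F 𝔠 γ hγ hγ1 K k h ∧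
    U ∈ AlphaInputsT3AC.reg68LocalSet F 𝔠 γ hγ hγ1 K k h ∧
    U ∈ AlphaInputsT3AC.large67RecSet F 𝔠 γ hγ hγ1 K k h ∧
    (ChargedT3 F γ 𝔠.b₀ 𝔠.p₀ (avgWindowFactor F.L) K 𝔠.lane.carrier.M₁
        (rcolOf (T3Scales F γ hγ (hγ1.trans (sq_min_one_le _ 𝔠.gamma0_pos)) K) 𝔠.lane.carrier) k h W →
      U ∈ AlphaInputsT3AC.top42Set F 𝔠 γ hγ hγ1 K k h W ∧ U ∈ AlphaInputsT3AC.reg68LevelsSet F 𝔠 γ hγ hγ1 K k h)}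

end ClassXsDefs

/-- **THE ONE DISPLAYED CONSUMER ROW — COMB-LARGENESS FROM RECORDING-LARGENESS** (RULING g26-№8 (1): the comb↔symmetric seam confined to `hLF67`; hypothesis schema, never
asserted): at every admissible history of level `k ≤ K`, a configuration in the seam-blind small-loop class and the read-local (68) set that is (67)-large in RECORDING
currency is (67)-large in the [B7] COMB currency `large67Set` read by the tower's `hLF67` row (→ the (69)–(71) small factors).  To be discharged by a comparison lemma
«`dist1 (plaqHol (avgIter (liftCfg U) j) p)` vs `dist1 (plaqHol ((blockAvg ℰp)^j U) p)` on read-regular `U`» with the threshold loss absorbed in the small factor, or by a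
symmetric-letter re-reading of (69)–(71); OPEN. [cite: Balaban1985UV3, (67)–(71) p.273; Balaban1985Averaging, (42)–(43) p.25] -/
def AlphaInputsT3AC.Large67CombOfRecT3 (F : T3Family) (𝔠 : AlphaConsts F.L (suGroupModel 2).N) (γ : ℝ) (hγ : 0 < γ)
    (hγ1 : γ ≤ (min 𝔠.gamma0 1) ^ 2) (K : ℕ) : Prop :=
  ∀ (k : ℕ), k ≤ K → ∀ (h : Hist (F.P K) k),
    Hist.Admissible 𝔠.lane.carrier.M₁ (rcolOf (T3Scales F γ hγ (hγ1.trans (sq_min_one_le _ 𝔠.gamma0_pos)) K) 𝔠.lane.carrier) k h →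
    ∀ (U : GaugeField (F.P K) 0 (Matrix.specialUnitaryGroup (Fin 2) ℂ)),
      U ∈ AlphaInputsT3AC.localSmallT3X F 𝔠 γ hγ hγ1 K k h → U ∈ AlphaInputsT3AC.reg68LocalSet F 𝔠 γ hγ hγ1 K k h →
      U ∈ AlphaInputsT3AC.large67RecSet F 𝔠 γ hγ hγ1 K k h → U ∈ AlphaInputsT3AC.large67Set F 𝔠 γ hγ hγ1 K k h

section ClassXs

variable {F : T3Family} {𝔠 : AlphaConsts F.L (suGroupModel 2).N} {γ : ℝ} {hγ : 0 < γ} {hγ1 : γ ≤ (min 𝔠.gamma0 1) ^ 2} {K : ℕ}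

/-- Unfolding membership in `𝒞_Xs`. [folklore] -/
theorem AlphaInputsT3AC.mem_adaptedClassT3Xs_iff {k : ℕ} {h : Hist (F.P K) k} {W : GaugeField (F.P K) k (Matrix.specialUnitaryGroup (Fin 2) ℂ)}
    {U : GaugeField (F.P K) 0 (Matrix.specialUnitaryGroup (Fin 2) ℂ)} :
    U ∈ AlphaInputsT3AC.adaptedClassT3Xs F 𝔠 γ hγ hγ1 K k h W ↔
      U ∈ AlphaInputsT3AC.localSmallT3X F 𝔠 γ hγ hγ1 K k h ∧
      U ∈ AlphaInputsT3AC.reg68LocalSet F 𝔠 γ hγ hγ1 K k h ∧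
      U ∈ AlphaInputsT3AC.large67RecSet F 𝔠 γ hγ hγ1 K k h ∧
      (ChargedT3 F γ 𝔠.b₀ 𝔠.p₀ (avgWindowFactor F.L) K 𝔠.lane.carrier.M₁
          (rcolOf (T3Scales F γ hγ (hγ1.trans (sq_min_one_le _ 𝔠.gamma0_pos)) K) 𝔠.lane.carrier) k h W →
        U ∈ AlphaInputsT3AC.top42Set F 𝔠 γ hγ hγ1 K k h W ∧ U ∈ AlphaInputsT3AC.reg68LevelsSet F 𝔠 γ hγ hγ1 K k h) :=
  Iff.rfl

/-- **r-67 IS BOOKKEEPING IN RECORDING CURRENCY**: if the `j`-fold symmetric averages of `Ũ` have, at every recorded plaquette `p ∈ P_j(h)`, the same plaquette variable as frozen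
fields `V j` (print's constraint (3) «`Ū^j = V_j` on `Λ_j`», read at the four bonds of `p`) and the frozen fields are recorded-large there (`stepWeight`'s ζ-clause), then
`Ũ ∈ large67RecSet`. [cite: Balaban1985Variational, (3) p.278; Balaban1985UV3, (7) p.257 + (67) p.273] -/
theorem AlphaInputsT3AC.mem_large67RecSet_of_plaqHol_eq {k : ℕ} {h : Hist (F.P K) k} {U : GaugeField (F.P K) 0 (Matrix.specialUnitaryGroup (Fin 2) ℂ)}
    (V : (j : ℕ) → GaugeField (F.P K) j (Matrix.specialUnitaryGroup (Fin 2) ℂ))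
    (hV : ∀ (j : Fin k) (p : Plaq (F.P K) j), p ∈ h j →
      GaugeField.plaqHol (Averaging.iter (fun l => BlockAveraging.blockAvg (P := F.P K) (j := l) ℰp) j U) p = GaugeField.plaqHol (V j) p)
    (hrec : ∀ (j : Fin k) (p : Plaq (F.P K) j), p ∈ h j →
      eps1Of (T3Scales F γ hγ (hγ1.trans (sq_min_one_le _ 𝔠.gamma0_pos)) K) 𝔠.lane.carrier j ≤ GaugeGroup.dist1 (GaugeField.plaqHol (V j) p)) :
    U ∈ AlphaInputsT3AC.large67RecSet F 𝔠 γ hγ hγ1 K k h := by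
  intro j p hp
  rw [hV j p hp]
  exact hrec j p hp

/-- **`𝒞_Xs ⊆ 𝒞_X` UNDER THE SEAM ROW** at an admissible history of level `k ≤ K`. [cite: Balaban1985UV3, (42) p.266 + (67)–(68) p.273] -/
theorem AlphaInputsT3AC.adaptedClassT3Xs_subset_adaptedClassT3X (hseam : AlphaInputsT3AC.Large67CombOfRecT3 F 𝔠 γ hγ hγ1 K) {k : ℕ} (hk : k ≤ K)
    {h : Hist (F.P K) k} (hh : Hist.Admissible 𝔠.lane.carrier.M₁ (rcolOf (T3Scales F γ hγ (hγ1.trans (sq_min_one_le _ 𝔠.gamma0_pos)) K) 𝔠.lane.carrier) k h)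
    (W : GaugeField (F.P K) k (Matrix.specialUnitaryGroup (Fin 2) ℂ)) :
    AlphaInputsT3AC.adaptedClassT3Xs F 𝔠 γ hγ hγ1 K k h W ⊆ AlphaInputsT3AC.adaptedClassT3X F 𝔠 γ hγ hγ1 K k h W := by
  intro U hU
  obtain ⟨hS, hR, hL, hrel⟩ := hU
  exact ⟨hS, hR, hseam k hk h hh U hS hR hL, hrel⟩

end ClassXs

/-! ## §2 The selection rows over `𝒞_Xs` and their transport to the comb-currency rows under the seam row -/

section SchemaXs

variable (F : T3Family) (𝔠 : AlphaConsts F.L (suGroupModel 2).N) (γ : ℝ) (hγ : 0 < γ) (hγ1 : γ ≤ (min 𝔠.gamma0 1) ^ 2)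

/-- **A MEASURABLE IN-CLASS MINIMISER SELECTION OVER `𝒞_Xs`** (hypothesis schema, never asserted): `InClassSelT3X` with `𝒞_X ↦ 𝒞_Xs` — pinned to `Ut` at `triv`, measurable, and in
`𝒞_Xs(k, h, W)` at every admissible non-trivial history of level `k ≤ K`.  B1's row for PRINT's minimiser map: (3) + recording give the (67) conjunct for free
(`mem_large67RecSet_of_plaqHol_eq`); the rest is [Balaban1985Variational] Thm 1's regional regularity. [cite: Balaban1985UV3, (42) p.266 + (67)–(68) p.273; Balaban1985Variational, Thm 1 (8) p.279] -/
def AlphaInputsT3AC.InClassSelT3Xs (K : ℕ)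
    (Ut : (k : ℕ) → GaugeField (F.P K) k (Matrix.specialUnitaryGroup (Fin 2) ℂ) → GaugeField (F.P K) 0 (Matrix.specialUnitaryGroup (Fin 2) ℂ))
    (UkH : (k : ℕ) → Hist (F.P K) k → GaugeField (F.P K) k (Matrix.specialUnitaryGroup (Fin 2) ℂ) →
      GaugeField (F.P K) 0 (Matrix.specialUnitaryGroup (Fin 2) ℂ)) : Prop :=
  (∀ k, UkH k (Hist.triv (F.P K) k) = Ut k) ∧
  (∀ (k : ℕ) (h : Hist (F.P K) k), Measurable (UkH k h)) ∧
  (∀ (k : ℕ), k ≤ K → ∀ (h : Hist (F.P K) k),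
    Hist.Admissible 𝔠.lane.carrier.M₁ (rcolOf (T3Scales F γ hγ (hγ1.trans (sq_min_one_le _ 𝔠.gamma0_pos)) K) 𝔠.lane.carrier) k h →
    h ≠ Hist.triv (F.P K) k →
    ∀ (W : GaugeField (F.P K) k (Matrix.specialUnitaryGroup (Fin 2) ℂ)), UkH k h W ∈ AlphaInputsT3AC.adaptedClassT3Xs F 𝔠 γ hγ hγ1 K k h W)

/-- **(O‴χₛ) THE χ CLUSTER-EXPANSION DATA ROWS FOR A HANDED SELECTION IN `𝒞_Xs`** (hypothesis schema, never asserted): `DataRowsT3XChiSel` with `InClassSelT3X ↦ InClassSelT3Xs`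
— the three data conjuncts VERBATIM. [cite: Balaban1985UV3, Thm 2 p.272 + (41)–(42) p.266 + (47) p.267 + (55) p.269] -/
def AlphaInputsT3AC.DataRowsT3XsChiSel (K : ℕ)
    (Ut : (k : ℕ) → GaugeField (F.P K) k (Matrix.specialUnitaryGroup (Fin 2) ℂ) → GaugeField (F.P K) 0 (Matrix.specialUnitaryGroup (Fin 2) ℂ)) : Prop :=
  ∃ (UkH : (k : ℕ) → Hist (F.P K) k → GaugeField (F.P K) k (Matrix.specialUnitaryGroup (Fin 2) ℂ) →
      GaugeField (F.P K) 0 (Matrix.specialUnitaryGroup (Fin 2) ℂ))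
    (hU0 : ∀ V : GaugeField (F.P K) 0 (Matrix.specialUnitaryGroup (Fin 2) ℂ), UkH 0 (Hist.triv (F.P K) 0) V = V),
    AlphaInputsT3AC.InClassSelT3Xs F 𝔠 γ hγ hγ1 K Ut UkH ∧
    ∃ (𝔖 : ∀ k, StepSeries (T3Scales F γ hγ (hγ1.trans (sq_min_one_le _ 𝔠.gamma0_pos)) K)
        (Matrix.specialUnitaryGroup (Fin 2) ℂ) ↥(lieC (suGroupModel 2))
        (nblkOf (T3Scales F γ hγ (hγ1.trans (sq_min_one_le _ 𝔠.gamma0_pos)) K) 𝔠.lane.carrier k) k)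
      (𝔄 : AlphaDataAC (suGroupModel 2) 𝔠
        (XT3 F γ hγ (hγ1.trans (sq_min_one_le _ 𝔠.gamma0_pos)) K (fun _ => Set.univ)
          (fun k => UkH (k + 1) (Hist.triv (F.P K) (k + 1))) UkH hU0 (fun _ _ => rfl)) 𝔖),
      (∀ k, k + 1 ≤ K → StepDataV3ChiAC (suGroupModel 2) 𝔠
        (XT3 F γ hγ (hγ1.trans (sq_min_one_le _ 𝔠.gamma0_pos)) K (fun _ => Set.univ)
          (fun k => UkH (k + 1) (Hist.triv (F.P K) (k + 1))) UkH hU0 (fun _ _ => rfl)) 𝔖 𝔄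
        (AlphaInputsT3AC.admWindowT3 F 𝔠 γ hγ hγ1 K) k) ∧
      (∀ h : Hist (F.P K) K, Measurable ((inputOfAC 𝔠.lane
        (XT3 F γ hγ (hγ1.trans (sq_min_one_le _ 𝔠.gamma0_pos)) K (fun _ => Set.univ)
          (fun k => UkH (k + 1) (Hist.triv (F.P K) (k + 1))) UkH hU0 (fun _ _ => rfl)) 𝔖).Pint K h)) ∧
      (∀ (h : Hist (F.P K) K) (U : GaugeField (F.P K) K (Matrix.specialUnitaryGroup (Fin 2) ℂ)), (inputOfAC 𝔠.lane
        (XT3 F γ hγ (hγ1.trans (sq_min_one_le _ 𝔠.gamma0_pos)) K (fun _ => Set.univ)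
          (fun k => UkH (k + 1) (Hist.triv (F.P K) (k + 1))) UkH hU0 (fun _ _ => rfl)) 𝔖).Pint K h U ≤ 𝔄.cP K)

variable {F 𝔠 γ hγ hγ1}

/-- **`InClassSelT3Xs ⇒ InClassSelT3X` UNDER THE SEAM ROW.** [cite: Balaban1985UV3, (67)–(68) p.273] -/
theorem AlphaInputsT3AC.inClassSelT3X_of_Xs {K : ℕ} (hseam : AlphaInputsT3AC.Large67CombOfRecT3 F 𝔠 γ hγ hγ1 K)
    {Ut : (k : ℕ) → GaugeField (F.P K) k (Matrix.specialUnitaryGroup (Fin 2) ℂ) → GaugeField (F.P K) 0 (Matrix.specialUnitaryGroup (Fin 2) ℂ)}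
    {UkH : (k : ℕ) → Hist (F.P K) k → GaugeField (F.P K) k (Matrix.specialUnitaryGroup (Fin 2) ℂ) →
      GaugeField (F.P K) 0 (Matrix.specialUnitaryGroup (Fin 2) ℂ)}
    (hsel : AlphaInputsT3AC.InClassSelT3Xs F 𝔠 γ hγ hγ1 K Ut UkH) : AlphaInputsT3AC.InClassSelT3X F 𝔠 γ hγ hγ1 K Ut UkH :=
  ⟨hsel.1, hsel.2.1, fun k hk h hh ht W =>
    AlphaInputsT3AC.adaptedClassT3Xs_subset_adaptedClassT3X hseam hk hh W (hsel.2.2 k hk h hh ht W)⟩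

/-- **(O‴χₛ) + THE SEAM ROW ⇒ (O‴χ)** (same handed map, same data). [cite: Balaban1985UV3, Thm 2 p.272 + (67)–(68) p.273] -/
theorem AlphaInputsT3AC.dataRowsT3XChiSel_of_Xs {K : ℕ} (hseam : AlphaInputsT3AC.Large67CombOfRecT3 F 𝔠 γ hγ hγ1 K)
    {Ut : (k : ℕ) → GaugeField (F.P K) k (Matrix.specialUnitaryGroup (Fin 2) ℂ) → GaugeField (F.P K) 0 (Matrix.specialUnitaryGroup (Fin 2) ℂ)}
    (hD : AlphaInputsT3AC.DataRowsT3XsChiSel F 𝔠 γ hγ hγ1 K Ut) : AlphaInputsT3AC.DataRowsT3XChiSel F 𝔠 γ hγ hγ1 K Ut := by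
  obtain ⟨UkH, hU0, hsel, 𝔖, 𝔄, hsteps, hPm, hPb⟩ := hD
  exact ⟨UkH, hU0, AlphaInputsT3AC.inClassSelT3X_of_Xs hseam hsel, 𝔖, 𝔄, hsteps, hPm, hPb⟩

end SchemaXs

/-! ## §3 The record-parametric selection display over `𝒞_Xs`, the registered 2′χ text and the crux from it -/

/-- **2′χ DISPLAYED WITH A HANDED SELECTION IN ONE CURRENCY** (hypothesis schema, OPEN, never asserted): `PinnedPartsT3ACRecSelChi L` with, per family, the pair «the displayed
seam row `Large67CombOfRecT3` at every `(γ, K)`» ∧ «(O‴χₛ) for some pinned [7]-family whenever one exists».  The display for PRINT's map under RULING g26-№8.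
[cite: Balaban1985UV3, (7) p.257, (40)–(42) p.266, (47) p.267, (67)–(68) p.273 and Thm 2 p.272; Balaban1985Variational, Thm 1 (6)–(8) pp.278–279] -/
def AlphaInputsT3AC.PinnedPartsT3ACRecSelXsChi (L : ℕ) : Prop :=
  ∃ (b₁ p₁ : ℝ), ∀ (b₀ p₀ : ℝ), b₁ ≤ b₀ → p₁ ≤ p₀ →
    ∃ (𝔠 : AlphaConsts L (suGroupModel 2).N) (a₀ a₁ : ℝ), 𝔠.b₀ = b₀ ∧ 𝔠.p₀ = p₀ ∧ 0 < a₀ ∧ 0 < a₁ ∧ 𝔠.B₃ * a₁ ≤ a₀ ∧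
      (143 * ((((3 + 4 : ℕ) : ℝ)) ^ 2 / 4) ^ 2) * (2 * (𝔠.B₃ * a₁)) ≤ 1 / 3 ∧
      2 * (2 * (𝔠.B₃ * a₁)) ≤ 2 * deltaSU (Fin 2) / (((3 + 4) * L : ℕ) : ℝ) ^ 2 ∧
      1 ≤ 2 * 𝔠.B₃ ∧ 4 * 𝔠.B₃ * (L : ℝ) ^ 2 * avgWindowFactor L ≤ 𝔠.C68 ∧
      Real.exp (𝔠.p₀ - 1) ≤ 3 * C0 3 * 𝔠.C68 * (𝔠.b₀ * Q0 𝔠.p₀) ∧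
      (𝔠.b₀ * Q0 𝔠.p₀) * (2 * (L : ℝ) ^ 2 * avgWindowFactor L) ^ 2 ≤ 3 * C0 3 * 𝔠.C68 * a₁ ^ 2 ∧
      Thm1GlobalMinAt L a₀ a₁ 𝔠.B₃ ∧
      ∀ (F : T3Family) (hF : F.L = L),
        (∀ (γ : ℝ) (hγ : 0 < γ) (hγ1 : γ ≤ (min (hF ▸ 𝔠).gamma0 1) ^ 2) (K : ℕ), AlphaInputsT3AC.Large67CombOfRecT3 F (hF ▸ 𝔠) γ hγ hγ1 K) ∧
        ∀ (γ : ℝ) (hγ : 0 < γ) (hγ1 : γ ≤ (min (hF ▸ 𝔠).gamma0 1) ^ 2) (K : ℕ),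
          (∃ Ut : (k : ℕ) → GaugeField (F.P K) k (Matrix.specialUnitaryGroup (Fin 2) ℂ) → GaugeField (F.P K) 0 (Matrix.specialUnitaryGroup (Fin 2) ℂ),
            AlphaInputsT3AC.TrivMinimiserRowsT3 F (hF ▸ 𝔠) γ hγ hγ1 a₀ a₁ K Ut) →
          ∃ Ut : (k : ℕ) → GaugeField (F.P K) k (Matrix.specialUnitaryGroup (Fin 2) ℂ) → GaugeField (F.P K) 0 (Matrix.specialUnitaryGroup (Fin 2) ℂ),
            AlphaInputsT3AC.TrivMinimiserRowsT3 F (hF ▸ 𝔠) γ hγ hγ1 a₀ a₁ K Ut ∧ AlphaInputsT3AC.DataRowsT3XsChiSel F (hF ▸ 𝔠) γ hγ hγ1 K Ut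

/-- **THE ONE-CURRENCY DISPLAY IMPLIES THE SELECTION DISPLAY** (`PinnedPartsT3ACRecSelXsChi L → PinnedPartsT3ACRecSelChi L`: per family the seam row transports (O‴χₛ) to (O‴χ)).
[cite: Balaban1985UV3, Thm 2 p.272 + (67)–(68) p.273] -/
theorem AlphaInputsT3AC.pinnedPartsT3ACRecSelChi_of_recSelXsChi {L : ℕ} (h : AlphaInputsT3AC.PinnedPartsT3ACRecSelXsChi L) :
    AlphaInputsT3AC.PinnedPartsT3ACRecSelChi L := by
  obtain ⟨b₁, p₁, h⟩ := h
  refine ⟨b₁, p₁, fun b₀ p₀ hb hp => ?_⟩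
  obtain ⟨𝔠, a₀, a₁, h1, h2, h3, h4, h5, hA3, hA2, hB₃, hC, hCe, hCa, hT, hD⟩ := h b₀ p₀ hb hp
  refine ⟨𝔠, a₀, a₁, h1, h2, h3, h4, h5, hA3, hA2, hB₃, hC, hCe, hCa, hT, fun F hF γ hγ hγ1 K hex => ?_⟩
  obtain ⟨Ut, hUt, hDs⟩ := (hD F hF).2 γ hγ hγ1 K hex
  exact ⟨Ut, hUt, AlphaInputsT3AC.dataRowsT3XChiSel_of_Xs ((hD F hF).1 γ hγ hγ1 K) hDs⟩

/-- ★★★ **THE STUB 2′χ FROM ITS ONE-CURRENCY SELECTION DISPLAY**: `PinnedPartsT3ACRecSelXsChi L → AlphaInputsT3ACv3RecChi L`.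
[cite: Balaban1985UV3, Thm 2 p.272 + (47) p.267; Balaban1985Variational, Thm 1 (8) p.279] -/
theorem alphaInputsT3ACv3RecChi_of_pinnedPartsRecSelXsChi {L : ℕ} (h : AlphaInputsT3AC.PinnedPartsT3ACRecSelXsChi L) : AlphaInputsT3ACv3RecChi L :=
  alphaInputsT3ACv3RecChi_of_pinnedPartsRecSelChi (AlphaInputsT3AC.pinnedPartsT3ACRecSelChi_of_recSelXsChi h)

/-- **`HistoryTailL` FROM THE ONE-CURRENCY SELECTION DISPLAY at every odd block size `L > 1`** — stmt-QuantumFields-19936 PROVED MODULO the displayed predicate, not a proof of the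
crux. [cite: Balaban1985UV3, (5) p.256, (47) p.267 and (71) p.273; Balaban1985Variational, Thm 1 (8) p.279] -/
theorem historyTailL_of_pinnedPartsRecSelXsChi
    (h : ∀ L : ℕ, Odd L → 1 < L → AlphaInputsT3AC.PinnedPartsT3ACRecSelXsChi L) :
    Summit.QuantumFields.YangMills.Theses.UnitScaleTilt.HistoryTailL :=
  historyTailL_of_pinnedPartsRecSelChi fun L hLo hL => AlphaInputsT3AC.pinnedPartsT3ACRecSelChi_of_recSelXsChi (h L hLo hL)

end Summit.QuantumFields.YangMills.Theorems

/-! ## §4 The one-supplier closer in one currency -/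

namespace Summit.QuantumFields.YangMills.Theorems.HistoryTailSelSupplier

open MeasureTheory Set
open scoped Matrix.Norms.L2Operator
open Literature.MathematicalPhysics.QuantumFieldTheory.Balaban1983to89
open Literature.MathematicalPhysics.QuantumFieldTheory.Balaban1983to89.T3ContinuumYM3Torus
open Literature.MathematicalPhysics.QuantumFieldTheory.Balaban1983to89.T3PrintedMinimiserExistence (Thm1GlobalMinAt)
open Literature.MathematicalPhysics.QuantumFieldTheory.Balaban1983to89.T3LowerAlongMinimisersSplit (MinimisersIn8At)
open Literature.MathematicalPhysics.QuantumFieldTheory.Balaban1983to89.ExpMeanLog (deltaSU)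
open Literature.MathematicalPhysics.QuantumFieldTheory.Balaban1985CMP102.Setting
open Summit.QuantumFields.Balaban3D.Carriers
open Summit.QuantumFields.Balaban3D.Proofs.Primitives
open Summit.QuantumFields.Balaban3D.Proofs.Thresholds (Q0 Q0_pos)
open B7Prop2Explicit (C0 C0_pos)

/-- ★★★ **`HistoryTailL` ⇐ ⟨v5kC's `stub_thm1In8GlobalMin` TEXT⟩ ∧ (∀ odd `L > 1`, THE ONE-CURRENCY SELECTION SUPPLIER ROWS)** — `historyTailL_of_thm1In8_selDataRows_allL` with the
per-family∕`(γ, K)` supplier row := «the displayed seam row `Large67CombOfRecT3`» ∧ «(O‴χₛ): ONE measurable minimiser selection in `𝒞_Xs` (print's map: (3) + recording give its (67)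
conjunct by `mem_large67RecSet_of_plaqHol_eq`) with its [Balaban1985UV3] Sect. B–C χ-data, for some pinned [7]-family whenever one exists».  So 19936 BY NAME = ⟨T8⟩ ∧ ⟨∀ odd L: the
comb↔symmetric comparison row + print's minimiser map in `𝒞_Xs` + its expansion data⟩. [cite: Balaban1985UV3, (5) p.256, (47) p.267, (67)–(71) p.273 and Thm 2 p.272; Balaban1985Variational, Thm 1 (8) p.279; King1986, (3.12) p.657] -/
theorem historyTailL_of_thm1In8_selXsDataRows_allL
    (hT8 : ∀ L : ℕ, Odd L → 1 < L → ∃ a₀ a₁ B₃ : ℝ, 0 < a₀ ∧ 0 < a₁ ∧ 0 < B₃ ∧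
      Thm1GlobalMinAt L a₀ a₁ B₃ ∧ MinimisersIn8At L a₀ a₁ B₃)
    (hrows : ∀ L : ℕ, Odd L → 1 < L → ∃ (B₀ A₀ A₁ : ℝ), 0 < A₀ ∧ 0 < A₁ ∧
      ∀ (B a₀ a₁ : ℝ), B₀ ≤ B → 1 ≤ 2 * B → 0 < a₀ → a₀ ≤ A₀ → 0 < a₁ → a₁ ≤ A₁ → B * a₁ ≤ a₀ →
        (143 * ((((3 + 4 : ℕ) : ℝ)) ^ 2 / 4) ^ 2) * (2 * (B * a₁)) ≤ 1 / 3 →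
        2 * (2 * (B * a₁)) ≤ 2 * deltaSU (Fin 2) / (((3 + 4) * L : ℕ) : ℝ) ^ 2 →
        Thm1GlobalMinAt L a₀ a₁ B →
        ∃ (b₁ p₁ : ℝ), ∀ (b₀ p₀ : ℝ), b₁ ≤ b₀ → p₁ ≤ p₀ →
          ∃ 𝔠 : AlphaConsts L (suGroupModel 2).N, 𝔠.b₀ = b₀ ∧ 𝔠.p₀ = p₀ ∧ 𝔠.B₃ = B ∧
            4 * 𝔠.B₃ * (L : ℝ) ^ 2 * avgWindowFactor L ≤ 𝔠.C68 ∧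
            Real.exp (𝔠.p₀ - 1) ≤ 3 * C0 3 * 𝔠.C68 * (𝔠.b₀ * Q0 𝔠.p₀) ∧
            (𝔠.b₀ * Q0 𝔠.p₀) * (2 * (L : ℝ) ^ 2 * avgWindowFactor L) ^ 2 ≤ 3 * C0 3 * 𝔠.C68 * a₁ ^ 2 ∧
            ∀ (F : T3Family) (hF : F.L = L),
              (∀ (γ : ℝ) (hγ : 0 < γ) (hγ1 : γ ≤ (min (hF ▸ 𝔠).gamma0 1) ^ 2) (K : ℕ),
                AlphaInputsT3AC.Large67CombOfRecT3 F (hF ▸ 𝔠) γ hγ hγ1 K) ∧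
              ∀ (γ : ℝ) (hγ : 0 < γ) (hγ1 : γ ≤ (min (hF ▸ 𝔠).gamma0 1) ^ 2) (K : ℕ),
                (∃ Ut : (k : ℕ) → GaugeField (F.P K) k (Matrix.specialUnitaryGroup (Fin 2) ℂ) →
                    GaugeField (F.P K) 0 (Matrix.specialUnitaryGroup (Fin 2) ℂ),
                  AlphaInputsT3AC.TrivMinimiserRowsT3 F (hF ▸ 𝔠) γ hγ hγ1 a₀ a₁ K Ut) →
                ∃ Ut : (k : ℕ) → GaugeField (F.P K) k (Matrix.specialUnitaryGroup (Fin 2) ℂ) →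
                    GaugeField (F.P K) 0 (Matrix.specialUnitaryGroup (Fin 2) ℂ),
                  AlphaInputsT3AC.TrivMinimiserRowsT3 F (hF ▸ 𝔠) γ hγ hγ1 a₀ a₁ K Ut ∧
                    AlphaInputsT3AC.DataRowsT3XsChiSel F (hF ▸ 𝔠) γ hγ hγ1 K Ut) :
    Summit.QuantumFields.YangMills.Theses.UnitScaleTilt.HistoryTailL := by
  refine historyTailL_of_thm1In8_selDataRows_allL hT8 fun L hLo hL => ?_
  obtain ⟨B₀, A₀, A₁, hA₀, hA₁, h⟩ := hrows L hLo hL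
  refine ⟨B₀, A₀, A₁, hA₀, hA₁, fun B a₀ a₁ hB h2B ha₀ ha₀A ha₁ ha₁A hwin hA3 hA2 hT => ?_⟩
  obtain ⟨b₁, p₁, hrec⟩ := h B a₀ a₁ hB h2B ha₀ ha₀A ha₁ ha₁A hwin hA3 hA2 hT
  refine ⟨b₁, p₁, fun b₀ p₀ hb hp => ?_⟩
  obtain ⟨𝔠, h1, h2, h3, s1, s2, s3, hFO⟩ := hrec b₀ p₀ hb hp
  refine ⟨𝔠, h1, h2, h3, s1, s2, s3, fun F hF γ hγ hγ1 K hex => ?_⟩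
  obtain ⟨Ut, hUt, hDs⟩ := (hFO F hF).2 γ hγ hγ1 K hex
  exact ⟨Ut, hUt, AlphaInputsT3AC.dataRowsT3XChiSel_of_Xs ((hFO F hF).1 γ hγ hγ1 K) hDs⟩

end Summit.QuantumFields.YangMills.Theorems.HistoryTailSelSupplier

end
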